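import Summits.QuantumFields.BalabanUV.T4Continuum.Support.ShellMeasurePinnedNormEta
import Summits.QuantumFields.BalabanUV.T4Continuum.Support.ShellMeasureLiveEndLevelBlind

/-!
# `T4Continuum.ShellMeasureLiveEndLevelBlindRows` — F-ne7cp1-g34-1 item (c) and test (iv) ANSWERED FROM THE W-h SIDE:
# which (T2)∕(T3) numbers of THE ONE CALL are level-free — the decay-kernel ROW SUMS `M𝒢 Mι MH MH₁`, the located
# counts `Kw`∕`LK`, and the pin DEPTH of the block's own plaquettes — under the designed readings of S70∕S79
(cell `pub-balaban`, sub-cell `t4`, spine estimate NE7c (node U5b); NE7c ROUND-2 crew, unit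
`b2b-balaban-t4-ne7c-formalise-leaf-01` gen 9 — the lineage that wrote S70 (the LD chain in two norms,
`ShellMeasureLandau{WeightLocal,LocalEnd,PinnedEnd,LocalEndRay,PinnedEndRay}`, pin `pinW δ′ (pinDist B₀ ∘ pos)`) and S79
`ShellMeasurePinnedNormEta` (the owner's NOTE N-ne7cp1-g31-3 «η⁴ in the pinned kernel constants» in kernel); AUTHOR'S
ANSWER to the owner g34's FINDING F-ne7cp1-g34-1 (CLAIMS.log l.19650) item (c) «`M𝒢 Mι MH MH₁` ∕ `LK` are level-free
iff `Λz Λw Λx Λb` ∕ `𝔱` index COARSE objects — XREAD item for the S69∕S70∕S80 authors» and test (iv) «does `hϖPw` +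
`hdepthw` + «`ϖw = 0` on block bonds» give depth 0 for block plaquettes in S80 f3's designed reading (W-h authors)?»
(left open by the outside reader's verdict l.19724); INTENT l.19748; ADDITIVE — imports S79 `ShellMeasurePinnedNormEta`
(p226869: `K₁_le_of_pos`, `eta_pow_mul_K₁_le`, `eta_pow_mul_rowSum_le`, `sum_eta_exp_neg_pinDist_le`, `pl1_le_half`;
hence S69 `ShellMeasurePinnedNorm` `pinDist`∕`sum_mul_le_of_pinned` and S66 f3a `sum_exp_pl1_comp_le`) and the owner's
`ShellMeasureLiveEndLevelBlind` (p232084∕p232328: `depthZero_card_le`, `no_levelBlind_cap`) ONLY; [folklore]; 0 `def`,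
0 `def … : Prop`, 0 sorry, 0 citation tags)

HONEST FRAMING.  Finite four-torus programme, rung (B)+1 only — NOT infinite volume, NOT a mass gap, NOT the Clay
problem, NOT summit progress; (B), `BetaPertHyp`, (B^μ) not consumed.  NE7c (`T4IndicatorShell.ShellWeightBound`) is NOT
PRINTED in [Balaban 1983–89] and NOT PROVED; «NE7c ⇐ the named binders».  This file is ARITHMETIC on exponential torus
sums in the SHAPES of S80 f3's ∕ S92's binders under the DESIGNED READINGS of S70∕S79 (a fine-lattice kernel with the
density bound `c₀·η^d·e^{−δ₀·η·|x−y|_fine}`; `P_w` = ALL fine plaquettes of the block-sectioned Wilson action with their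
own bonds as read-out support; the (T3) E-terms on UNIT-lattice localization domains) — READINGS of printed TYPE
([Balaban1985BackgroundPropagators] (3.133)∕Thm 3.3, [Balaban1985Variational] (73)∕(190), B12 (2.18)–(2.22): LOCATORS,
displayed, nothing cited, nothing of Bałaban's discharged).  An audit of OUR wiring, like the owner's file: no kernel
error anywhere, S92 is correct as stated; the question is JOINT INHABITABILITY BY THE DESIGNED OBJECTS across levels.
HONEST DEPENDENCY (cell): continuum YM on T⁴ ⇐ BetaPertH ∧ nine spine estimates (0/9 proved); BetaPertH ⇐ (D1) ∧ (D4) ∧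
CAP+tail; G-an2-4 gates asym, D1 and NE2/3/4.

THE ANSWERS (η_j = L^{−j} the fine scale of live level `j`; «shared» = ONE real for every `(r, K, s)` as in S92 f1∕f2∕f3).
* (iv) **YES** (§1).  `pinDist B₀ x = 0` for `x ∈ B₀` (`pinDist_eq_zero_of_mem`), so with the S70∕S79 pin
  `ϖw := η·pinDist B₀ ∘ pos` the rows `hdepthw : ϖPw p ≤ ϖw (pos b′)` (`b′ ∈ suppw p`) and `hϖPw : 0 ≤ ϖPw p` force
  `ϖPw p = 0` for EVERY plaquette with a read-out bond in the block `{ϖw ∘ pos ≤ 0}` ∕ positioned in the reference set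
  `B₀` (`depth_eq_zero_of_touch`, `depth_eq_zero_of_mem_ref`), and then the owner's `depthZero_card_le` gives
  `#{such p} ≤ Kw` BY NAME (`card_blockPlaquettes_le_Kw`, in S80 f3's own letters).  In the designed reading `B₀ ⊇`
  the block's bond positions and `P_w` = all fine plaquettes (their own four bonds as `suppw`), so the block's
  `c_geo·η_j^{−4}` fine plaquettes all sit at depth 0: F-ne7cp1-g34-1 (b) CONFIRMED from the W-h side
  (`no_shared_Kw_of_blockPlaquettes` = the owner's `no_levelBlind_cap` over §1).
* (c) **CONFIRMED «LEVEL-FREE IFF COARSE»** for the row sums (§2–§3).  FINE reading (S79 §2's spelling: `Λz` = the fine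
  torus sites `(ℤ∕Nℤ)^d`, `N = η^{−1}`, `dis x y = η·pl1(x − y)` PHYSICAL): every summand of S92's
  `hM𝒢' : ∀ x, Σ_{b′} e^{−(δ𝒢−δw)·dis x (posz b′)} ≤ M𝒢` is `≥ e^{−(δ𝒢−δw)d∕2}` (`pl1_le_half`), so the row sum is
  `≥ N^d·e^{−(δ𝒢−δw)d∕2}` (`rowSum_fine_ge`) — NO shared real `M𝒢` inhabits `hM𝒢'` across the levels (`no_levelBlind_rowSum`,
  `no_levelBlind_rowSum_designed` at `N = L^j`): UNINHABITABLE, the same disease as `Kw`, not merely degenerate; the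
  level-INDEXED inhabitant is `M_j := m·(2(d+a)∕a)^d·η_j^{−d}` (`levelIndexed_rowSum`), while `c𝒢 := c₀` inhabits `hk𝒢`
  lossily and the PRODUCT `c·M` — the only combination entering `z_pin`, `hqW`, `hk` of S80 f3 — is level-free
  (`fine_product_le` = S79 §1; S79 (A-η) `opNorm_kerOpPin_eta_le`).  COARSE reading (`Λz` = UNIT-lattice cells placed on a
  unit torus `(ℤ∕Tℤ)^d` of ANY size, `≤ m` indices per cell, `dis = pl1` in cell units, cell spaces sup-normed): the row
  sum is `≤ m·(2(d+a)∕a)^d` — NO `T`, NO `η` (`rowSum_coarse_le`, `hM_coarse_inhabited` in S92's literal shape).  So for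
  S95: EITHER one docstring sentence fixing the designed reading of `Λz Λw Λw′ Λx Λb` as unit-cell index sets (no type
  change, `c· M·` stay shared reals), OR four more level profiles `M𝒢 Mι MH MH₁ : Bool → ℕ → ℝ` (fine reading) — both
  honest; the owner rules.
* `Kw` (§4): `P_w` is FINE in every reading (the action is a sum over fine plaquettes), so `Kw` MUST be level-indexed or
  volume-weighted: the CONSTRUCTIVE half of the owner's repair (b) — `hKw` IS inhabited AT EVERY LEVEL by
  `Kw_j := (#B₀·m·(2(d+δw)∕δw)^d)·η_j^{−d}` (`levelIndexed_Kw`, S79 §3 divided by `η^d`), the volume-weighted count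
  `Σ_p η^d·e^{−δw·ϖPw p}` being level-free (S79 `sum_eta_exp_neg_pinDist_le`, `B₀` the block's UNIT-lattice sites); the
  `η⁴` per plaquette is what the Wilson slot's `S̄² ∝ (κ̄_c z_pin)²` supplies (F-ne7cp1-g31-1), so `D r j` absorbs a
  level-free product exactly as the owner says.
* `LK` (§5): `(2e₀∕r_E)·#{i ∈ I ∣ ϖP i = 0} ≤ LK` whenever the depth-0 terms have size `≥ e₀` (`LK_ge_depthZero`): a FINE
  term index with O(1) sizes is level-blind-uninhabitable like `Kw`; the DESIGNED (T3) index (E-terms on UNIT-lattice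
  localization domains — COARSE) is level-free by S69 §4 `sum_mul_le_of_pinned` + `sum_exp_neg_pinDist_le` BY NAME
  (`#B₀`, `m`, `K₁ d δ′` level-free).
ONE SENTENCE PER REAL (owner R-ne7cp1-g34-3 (b), row S98; «coarse» = `Λ·` index UNIT-lattice cells with `dis = pl1` in
cell units, «fine» = `Λ·` index fine sites with `dis = η·pl1`):
* `M𝒢`, `Mι`, `MH`, `MH₁` (rows `hM·' : ∀ x, Σ_{b′} e^{−(δ·−δw)·dis x (pos· b′)} ≤ M·`): COARSE — level-free because the
  unit-torus row sum is `≤ m·(2(d+a)∕a)^d` for every torus size (`rowSum_coarse_le`); FINE — `∝ η_j^{−d}`, a third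
  instance of (b): NO shared real (`no_levelBlind_rowSum`), lift by level (`levelIndexed_rowSum`) — or better (leaf-06-g7's
  remark, l.19759) display the level-free PRODUCT `c·M` that alone feeds `z_pin`∕`hqW`∕`hk` (`fine_product_le`).
* `c𝒢`, `cι`, `cH`, `cH₁` (entry bounds `hk·`): COARSE — level-free (cell aggregate of the fine density); FINE —
  `c₀·η_j^{+d}`, inhabited lossily by the level-free `c₀`; harmless alone, but then `c·M ∝ η_j^{−d}` unless `M` is
  indexed — again: only the product is meaningful.
* `B₀w` and the flat op-norm rows `hιw`∕`hHw`∕`hH₁w`: level-free in BOTH readings (a flat sup-norm operator bound is a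
  max row sum of entries = the product `c·M`: `flatOpNorm_fine_le`; coarse: S66 f3a `opNorm_kerOp_le` + `rowSum_coarse_le`).
* `Kw` (row `hKw`): `∝ η_j^{−4}` in EVERY reading, because `P_w` is the FINE plaquette set — (b) itself; lift by level
  (`levelIndexed_Kw`), the `η_j⁴` coming from `S̄²`; (iv) the block's plaquettes are exactly the depth-0 ones (§1).
* `κwb`, `κcb`, `dbar`: `∝ η_j`, `η_j²`, `ε_jη_j²` — honest as shared UPPER bounds (level-0 values) but then the `η⁴` that
  tames `Kw_j` is invisible: lift by level together with `Kw` (the owner's wider lift, R-ne7cp1-g34-3 (a)).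
* `LK` (row `hK` of (T3)): level-free because the designed term index is COARSE (E-terms on unit-lattice localization
  domains; S69 §4 `sum_mul_le_of_pinned` with `#B₀`, `m`, `K₁ d δ′` level-free); a fine O(1)-size index would be
  `∝ η_j^{−4}` (`LK_ge_depthZero`) — not the designed reading.
NOTHING in the countdown moves; NE7c NOT PROVED; spine PROVED 0∕9.
-/

noncomputable section

open Set Metric

namespace Summit.QuantumFields.BalabanUV.T4Continuum.ShellMeasureLiveEndLevelBlindRows

open Literature.MathematicalPhysics.QuantumFieldTheory.Balaban1983to89
open ShellMeasureDecayKernelSums (kerOp opNorm_kerOp_le rowSum_le_of_decay sum_exp_pl1_comp_le)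
open ShellMeasurePinnedNorm (pinDist pinDist_nonneg)
open ShellMeasurePinnedNormEta (K₁_le_of_pos eta_pow_mul_K₁_le eta_pow_mul_rowSum_le sum_eta_exp_neg_pinDist_le
  pl1_le_half)
open ShellMeasureLiveEndLevelBlind (depthZero_card_le no_levelBlind_cap)
open TreeLengthTorus (TPt)
open B12Decay510Torus (pl1 pl1_nonneg pl1_eq_sum pabs_zero)
open B12Decay510Window (K₁ K₁_nonneg)

/-! ## §1 (iv): YES — every plaquette with a read-out bond in the reference set sits at pin depth `0` -/

section Depth

variable {d T : ℕ}

/-- The periodic ℓ¹ length of `0` is `0`. [folklore] -/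
theorem pl1_zero : pl1 (0 : TPt d T) = 0 := by
  rw [pl1_eq_sum]
  simp only [Pi.zero_apply, pabs_zero, Int.cast_zero, Finset.sum_const_zero]

/-- **THE TORUS PIN VANISHES ON THE REFERENCE SET**: `x ∈ B₀ ⟹ pinDist B₀ x = 0` (S69's DATA `pinDist B₀ x =
min_{x₀ ∈ B₀} pl1(x − x₀)`; the minimum is attained at `x₀ = x`). [folklore] -/
theorem pinDist_eq_zero_of_mem (B₀ : Finset (TPt d T)) (hB₀ : B₀.Nonempty) {x : TPt d T} (hx : x ∈ B₀) :
    pinDist B₀ hB₀ x = 0 := by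
  refine le_antisymm ?_ (pinDist_nonneg B₀ hB₀ x)
  have h : B₀.inf' hB₀ (fun x₀ => pl1 (x - x₀)) ≤ pl1 (x - x) := Finset.inf'_le _ hx
  rw [sub_self, pl1_zero] at h
  exact h

/-- **DEPTH ZERO BY TOUCHING** (S80 f3's ∕ S92's row shapes `hdepthw`, `hϖPw` verbatim, one slot): if plaquette `p ∈ P_w`
has a read-out bond `b′ ∈ suppw p` whose pin value is `≤ 0` — i.e. a bond of THE BLOCK in S80 f3's own convention
(the block is `{ϖw ∘ pos· ≤ 0}`: `hsupp : 0 < ϖw (posb i) → Φw V z i = 0`) — then `ϖPw p = 0`. [folklore] -/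
theorem depth_eq_zero_of_touch {𝔭 Λw 𝔖 : Type*} {Pw : Finset 𝔭} {suppw : 𝔭 → Finset Λw} {ϖPw : 𝔭 → ℝ}
    {ϖw : 𝔖 → ℝ} {pos : Λw → 𝔖}
    (hdepthw : ∀ p ∈ Pw, ∀ b' ∈ suppw p, ϖPw p ≤ ϖw (pos b')) (hϖPw : ∀ p ∈ Pw, 0 ≤ ϖPw p)
    {p : 𝔭} (hp : p ∈ Pw) {b' : Λw} (hb' : b' ∈ suppw p) (h0 : ϖw (pos b') ≤ 0) : ϖPw p = 0 :=
  le_antisymm ((hdepthw p hp b' hb').trans h0) (hϖPw p hp)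

/-- **TEST (iv) IN S80 f3's OWN LETTERS**: with the located count `hKw : Σ_{p ∈ P_w} e^{−δw·ϖPw p} ≤ Kw`, the number of
plaquettes of `P_w` reading a bond of the block `{ϖw ∘ pos ≤ 0}` is `≤ Kw` (the owner's `depthZero_card_le` BY NAME over
`depth_eq_zero_of_touch`).  In the designed reading (`P_w` = ALL fine plaquettes of the sectioned Wilson action, S70; their
own four bonds as `suppw`) every plaquette of the block reads a block bond, so this number is `≥ c_geo·η_j^{−4}`.
[folklore] -/
theorem card_blockPlaquettes_le_Kw {𝔭 Λw 𝔖 : Type*} (Pw : Finset 𝔭) (suppw : 𝔭 → Finset Λw) (ϖPw : 𝔭 → ℝ)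
    (ϖw : 𝔖 → ℝ) (pos : Λw → 𝔖) {δw Kw : ℝ}
    (hdepthw : ∀ p ∈ Pw, ∀ b' ∈ suppw p, ϖPw p ≤ ϖw (pos b')) (hϖPw : ∀ p ∈ Pw, 0 ≤ ϖPw p)
    (hKw : ∑ p ∈ Pw, Real.exp (-(δw * ϖPw p)) ≤ Kw) :
    ((Pw.filter fun p => ∃ b' ∈ suppw p, ϖw (pos b') ≤ 0).card : ℝ) ≤ Kw := by
  have hsub : (Pw.filter fun p => ∃ b' ∈ suppw p, ϖw (pos b') ≤ 0) ⊆ Pw.filter fun p => ϖPw p = 0 := by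
    intro p hp
    rw [Finset.mem_filter] at hp ⊢
    obtain ⟨hpP, b', hb', h0⟩ := hp
    exact ⟨hpP, depth_eq_zero_of_touch hdepthw hϖPw hpP hb' h0⟩
  calc ((Pw.filter fun p => ∃ b' ∈ suppw p, ϖw (pos b') ≤ 0).card : ℝ)
      ≤ ((Pw.filter fun p => ϖPw p = 0).card : ℝ) := by exact_mod_cast Finset.card_le_card hsub
    _ ≤ Kw := depthZero_card_le Pw ϖPw hKw

/-- **DEPTH ZERO IN THE DESIGNED READING** (the S70 f1 ∕ S74 f2 ∕ S79 pin `ϖw := η·pinDist B₀ ∘ pos`, PHYSICAL distance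
to the reference set `B₀`): every plaquette of `P_w` with a read-out bond POSITIONED IN `B₀` has `ϖPw p = 0`.
[folklore] -/
theorem depth_eq_zero_of_mem_ref {𝔭 Λw : Type*} {Pw : Finset 𝔭} {suppw : 𝔭 → Finset Λw}
    {ϖPw : 𝔭 → ℝ} (pos : Λw → TPt d T) (B₀ : Finset (TPt d T)) (hB₀ : B₀.Nonempty) (η : ℝ)
    (hdepthw : ∀ p ∈ Pw, ∀ b' ∈ suppw p, ϖPw p ≤ η * pinDist B₀ hB₀ (pos b')) (hϖPw : ∀ p ∈ Pw, 0 ≤ ϖPw p)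
    {p : 𝔭} (hp : p ∈ Pw) {b' : Λw} (hb' : b' ∈ suppw p) (hB : pos b' ∈ B₀) : ϖPw p = 0 :=
  depth_eq_zero_of_touch (ϖw := fun x => η * pinDist B₀ hB₀ x) (pos := pos) hdepthw hϖPw hp hb'
    (by simp only [pinDist_eq_zero_of_mem B₀ hB₀ hB, mul_zero, le_refl])

/-- **F-ne7cp1-g34-1 (b) FROM THE W-h SIDE**: over any index family (S92's `(r, K, t, s)`), if the count of block-reading
plaquettes is unbounded along the family (the designed `c_geo·L^{4j}`, owner's `designed_count_unbounded`), NO shared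
real `Kw` inhabits `hKw` at every index (the owner's `no_levelBlind_cap` over `card_blockPlaquettes_le_Kw`). [folklore] -/
theorem no_shared_Kw_of_blockPlaquettes {ι : Type*} {𝔭 Λw 𝔖 : ι → Type*} (Pw : ∀ i, Finset (𝔭 i))
    (suppw : ∀ i, 𝔭 i → Finset (Λw i)) (ϖPw : ∀ i, 𝔭 i → ℝ) (ϖw : ∀ i, 𝔖 i → ℝ) (pos : ∀ i, Λw i → 𝔖 i)
    {δw : ℝ} (hdepthw : ∀ i, ∀ p ∈ Pw i, ∀ b' ∈ suppw i p, ϖPw i p ≤ ϖw i (pos i b'))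
    (hϖPw : ∀ i, ∀ p ∈ Pw i, 0 ≤ ϖPw i p)
    (hN : ∀ B : ℕ, ∃ i, B < ((Pw i).filter fun p => ∃ b' ∈ suppw i p, ϖw i (pos i b') ≤ 0).card) :
    ¬ ∃ Kw : ℝ, ∀ i, ∑ p ∈ Pw i, Real.exp (-(δw * ϖPw i p)) ≤ Kw := by
  rintro ⟨Kw, hKw⟩
  exact no_levelBlind_cap (fun i => ((Pw i).filter fun p => ∃ b' ∈ suppw i p, ϖw i (pos i b') ≤ 0).card) hN
    ⟨Kw, fun i => card_blockPlaquettes_le_Kw (Pw i) (suppw i) (ϖPw i) (ϖw i) (pos i) (hdepthw i) (hϖPw i) (hKw i)⟩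

end Depth

/-! ## §2 (c), FINE READING: the reduced-rate row sum over the FINE sites at a PHYSICAL rate is `≥ N^d·e^{−ad∕2}` —
no level-blind `M𝒢 Mι MH MH₁` -/

section Fine

variable {d : ℕ}

/-- **THE FINE ROW SUM IS AT LEAST `N^d·e^{−ad∕2}`**: on the fine torus `(ℤ∕Nℤ)^d` (`η = 1∕N`) with the PHYSICAL distance
`dis x y = η·pl1(x − y)` (S79 §2's spelling) every summand of `Σ_y e^{−a·dis x y}` is `≥ e^{−ad∕2}` (`pl1 ≤ dN∕2`,
S79 `pl1_le_half`), and there are `N^d` of them. [folklore] -/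
theorem rowSum_fine_ge (N : ℕ) [NeZero N] {a : ℝ} (ha : 0 ≤ a) (x : TPt d N) :
    (N : ℝ) ^ d * Real.exp (-(a * d / 2)) ≤ ∑ y : TPt d N, Real.exp (-(a * ((1 / (N : ℝ)) * pl1 (x - y)))) := by
  have hN : (0 : ℝ) < N := by exact_mod_cast Nat.pos_of_ne_zero (NeZero.ne N)
  have hcard : (Fintype.card (TPt d N) : ℝ) = (N : ℝ) ^ d := by
    rw [Fintype.card_pi, Finset.prod_const, Finset.card_univ, Fintype.card_fin, ZMod.card]; push_cast; rfl
  have hterm : ∀ y : TPt d N, Real.exp (-(a * d / 2)) ≤ Real.exp (-(a * ((1 / (N : ℝ)) * pl1 (x - y)))) := by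
    intro y
    refine Real.exp_le_exp.2 (neg_le_neg ?_)
    have h1 : (1 / (N : ℝ)) * pl1 (x - y) ≤ d / 2 := by
      rw [one_div, inv_mul_le_iff₀ hN]
      have := pl1_le_half (x - y)
      linarith
    calc a * ((1 / (N : ℝ)) * pl1 (x - y)) ≤ a * (d / 2) := mul_le_mul_of_nonneg_left h1 ha
      _ = a * d / 2 := by ring
  calc (N : ℝ) ^ d * Real.exp (-(a * d / 2)) = ∑ _y : TPt d N, Real.exp (-(a * d / 2)) := by
        rw [Finset.sum_const, Finset.card_univ, nsmul_eq_mul, hcard]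
    _ ≤ ∑ y : TPt d N, Real.exp (-(a * ((1 / (N : ℝ)) * pl1 (x - y)))) := Finset.sum_le_sum fun y _ => hterm y

/-- **NO LEVEL-BLIND ROW SUM IN THE FINE READING** (`d ≥ 1`, `a ≥ 0`): there is NO real `M` with
`Σ_y e^{−a·(1∕N)·pl1(x − y)} ≤ M` for every fine torus `(ℤ∕Nℤ)^d` and every `x` — S92's SHARED `M𝒢` (row
`hM𝒢' : ∀ x, Σ_{b′} e^{−(δ𝒢−δw)·dis x (posz b′)} ≤ M𝒢`, `a = δ𝒢 − δw`) with `Λz` = the fine sites and `dis` physical is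
UNINHABITABLE across the levels, exactly like `Kw`. [folklore] -/
theorem no_levelBlind_rowSum (hd : 0 < d) {a : ℝ} (ha : 0 ≤ a) :
    ¬ ∃ M : ℝ, ∀ (N : ℕ) [NeZero N], ∀ x : TPt d N,
      ∑ y : TPt d N, Real.exp (-(a * ((1 / (N : ℝ)) * pl1 (x - y)))) ≤ M := by
  rintro ⟨M, hM⟩
  obtain ⟨B, hB⟩ := exists_nat_gt (M * Real.exp (a * d / 2))
  have h1 : (((B + 1 : ℕ) : ℝ)) ^ d * Real.exp (-(a * d / 2)) ≤ M :=
    (rowSum_fine_ge (d := d) (B + 1) ha 0).trans (hM (B + 1) 0)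
  have hexp : Real.exp (-(a * d / 2)) * Real.exp (a * d / 2) = 1 := by
    rw [← Real.exp_add, neg_add_cancel, Real.exp_zero]
  have h2 : (((B + 1 : ℕ) : ℝ)) ^ d ≤ M * Real.exp (a * d / 2) := by
    have := mul_le_mul_of_nonneg_right h1 (Real.exp_pos (a * d / 2)).le
    rwa [mul_assoc, hexp, mul_one] at this
  have h3 : (((B + 1 : ℕ) : ℝ)) ≤ (((B + 1 : ℕ) : ℝ)) ^ d :=
    le_self_pow₀ (by exact_mod_cast Nat.le_add_left 1 B) hd.ne'
  have h4 : (B : ℝ) < ((B + 1 : ℕ) : ℝ) := by exact_mod_cast Nat.lt_succ_self B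
  linarith

/-- **… AT BAŁABAN'S LEVELS `N = L^j`** (`L ≥ 2`): no real bounds the fine row sums of all live levels `j` (the levels of
all comparisons are unbounded — END-I's `hacA : ∀ K`). [folklore] -/
theorem no_levelBlind_rowSum_designed (hd : 0 < d) {L : ℕ} (hL : 2 ≤ L) {a : ℝ} (ha : 0 ≤ a) :
    ¬ ∃ M : ℝ, ∀ (j : ℕ) [NeZero (L ^ j)], ∀ x : TPt d (L ^ j),
      ∑ y : TPt d (L ^ j), Real.exp (-(a * ((1 / ((L ^ j : ℕ) : ℝ)) * pl1 (x - y)))) ≤ M := by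
  rintro ⟨M, hM⟩
  obtain ⟨B, hB⟩ := exists_nat_gt (M * Real.exp (a * d / 2))
  -- the level `j := B` already has `L^B > B` fine sites per direction (`B < 2^B ≤ L^B`)
  have hj : B < L ^ B := lt_of_lt_of_le Nat.lt_two_pow_self (Nat.pow_le_pow_left hL B)
  haveI : NeZero (L ^ B) := ⟨pow_ne_zero B (by omega)⟩
  have h1 : (((L ^ B : ℕ) : ℝ)) ^ d * Real.exp (-(a * d / 2)) ≤ M :=
    (rowSum_fine_ge (d := d) (L ^ B) ha 0).trans (hM B 0)
  have hexp : Real.exp (-(a * d / 2)) * Real.exp (a * d / 2) = 1 := by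
    rw [← Real.exp_add, neg_add_cancel, Real.exp_zero]
  have h2 : (((L ^ B : ℕ) : ℝ)) ^ d ≤ M * Real.exp (a * d / 2) := by
    have := mul_le_mul_of_nonneg_right h1 (Real.exp_pos (a * d / 2)).le
    rwa [mul_assoc, hexp, mul_one] at this
  have hL1 : (1 : ℝ) ≤ ((L ^ B : ℕ) : ℝ) := by exact_mod_cast Nat.one_le_pow B L (by omega)
  have h3 : (((L ^ B : ℕ) : ℝ)) ≤ (((L ^ B : ℕ) : ℝ)) ^ d := le_self_pow₀ hL1 hd.ne'
  have h4 : (B : ℝ) < ((L ^ B : ℕ) : ℝ) := by exact_mod_cast hj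
  linarith

variable {Λ : Type*} [Fintype Λ] {T : ℕ} [NeZero T]

/-- **THE LEVEL-INDEXED INHABITANT OF THE FINE ROW SUM**: indices placed on the fine torus (`≤ m` per fine site), rate
`a > 0` per PHYSICAL unit, `0 < η ≤ 1`, `d ≥ 1` ⟹ `Σ_b e^{−a·η·pl1(x − pos b)} ≤ (m·(2(d + a)∕a)^d)·η^{−d}` — S92's `hM·'`
holds AT EACH LEVEL with `M_j ∝ η_j^{−d}` (S79 `eta_pow_mul_rowSum_le` divided by `η^d`). [folklore] -/
theorem levelIndexed_rowSum (pos : Λ → TPt d T) {m : ℕ}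
    (hm : ∀ x, (Finset.univ.filter fun b => pos b = x).card ≤ m) (hd : 0 < d) {a η : ℝ} (ha : 0 < a)
    (hη : 0 < η) (hη1 : η ≤ 1) (x : TPt d T) :
    ∑ b, Real.exp (-(a * (η * pl1 (x - pos b)))) ≤ (m * (2 * (d + a) / a) ^ d) * (η ^ d)⁻¹ := by
  have h := eta_pow_mul_rowSum_le pos hm hd ha hη hη1 x
  rw [le_mul_inv_iff₀' (pow_pos hη d)]
  exact h

/-- **ONLY THE PRODUCT IS LEVEL-FREE** (N-ne7cp1-g31-3 in S92's letters): the designed fine kernel constant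
`c_j = c₀·η_j^d` (cell volume in the entry) times the fine row sum bound `M_j = m·K₁ d (aη_j)` (`∝ η_j^{−d}`) is
`≤ c₀·m·(2(d + a)∕a)^d` — the combination `c𝒢·M𝒢`, `cι·Mι`, `cH·MH`, `cH₁·MH₁` that ALONE enters S80 f3's `z_pin`, `hqW`,
`hk` (S79 §1 `eta_pow_mul_K₁_le`; the operator form is S79 (A-η) `opNorm_kerOpPin_eta_le`). [folklore] -/
theorem fine_product_le (hd : 0 < d) {c₀ a η : ℝ} (hc₀ : 0 ≤ c₀) (ha : 0 < a) (hη : 0 < η) (hη1 : η ≤ 1) (m : ℕ) :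
    (c₀ * η ^ d) * (m * K₁ d (a * η)) ≤ c₀ * (m * (2 * (d + a) / a) ^ d) := by
  have h := eta_pow_mul_K₁_le hd ha hη hη1
  calc (c₀ * η ^ d) * (m * K₁ d (a * η)) = c₀ * (m * (η ^ d * K₁ d (a * η))) := by ring
    _ ≤ c₀ * (m * (2 * (d + a) / a) ^ d) :=
        mul_le_mul_of_nonneg_left (mul_le_mul_of_nonneg_left h (Nat.cast_nonneg m)) hc₀

variable {Λ' : Type*} [Fintype Λ'] {𝔄 𝔅 : Type*} [NormedAddCommGroup 𝔄] [NormedSpace ℂ 𝔄]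
  [NormedAddCommGroup 𝔅] [NormedSpace ℂ 𝔅]

/-- **THE FLAT OP-NORM ROWS ARE LEVEL-FREE EVEN IN THE FINE READING** (S92's `h𝒢w : ‖kerOp (k𝒢 V) f‖ ≤ B₀w‖f‖`,
`hιw`, `hHw`, `hH₁w`): a fine-lattice kernel with the designed entry bound `‖k c b‖ ≤ c₀·η^d·e^{−δ·η·pl1(posOut c − posIn b)}`
(cell volume in the entry, PHYSICAL rate), `δ > 0`, `0 < η ≤ 1`, `d ≥ 1`, `≤ m` indices per fine site, has
`‖kerOp k‖ ≤ c₀·m·(2(d + δ)∕δ)^d` — the sup-norm operator bound IS a max row sum, i.e. the product `c·M`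
(S66 f3a `opNorm_kerOp_le`∕`rowSum_le_of_decay` + `fine_product_le`).  So `B₀w` needs no lift in either reading.
[folklore] -/
theorem flatOpNorm_fine_le (k : Λ' → Λ → (𝔄 →L[ℂ] 𝔅)) (posIn : Λ → TPt d T) (posOut : Λ' → TPt d T) {m : ℕ}
    (hm : ∀ x, (Finset.univ.filter fun b => posIn b = x).card ≤ m) (hd : 0 < d)
    {c₀ δ η : ℝ} (hc₀ : 0 ≤ c₀) (hδ : 0 < δ) (hη : 0 < η) (hη1 : η ≤ 1)
    (hk : ∀ c b, ‖k c b‖ ≤ c₀ * η ^ d * Real.exp (-(δ * (η * pl1 (posOut c - posIn b))))) :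
    ‖kerOp k‖ ≤ c₀ * (m * (2 * (d + δ) / δ) ^ d) := by
  refine opNorm_kerOp_le k (by positivity) fun c => ?_
  have hrow : ∑ b, ‖k c b‖ ≤ (c₀ * η ^ d) * (m * K₁ d (δ * η)) := by
    refine rowSum_le_of_decay k (fun x y => η * pl1 (x - y)) posIn posOut (by positivity) (fun c b => hk c b)
      (fun x => ?_) c
    have h := sum_exp_pl1_comp_le posIn hm (mul_pos hδ hη) x
    simpa only [mul_assoc] using h
  exact hrow.trans (fine_product_le hd hc₀ hδ hη hη1 m)

end Fine

/-! ## §3 (c), COARSE READING: indices on UNIT-lattice cells ⟹ the row sum is `≤ m·(2(d+a)∕a)^d`, no `T`, no `η` -/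

section Coarse

variable {Λz : Type*} [Fintype Λz] {d T : ℕ} [NeZero T]

/-- **THE COARSE ROW SUM IS LEVEL-FREE**: indices placed on a UNIT torus `(ℤ∕Tℤ)^d` of ANY size (`≤ m` per cell),
rate `a > 0` per cell unit, `d ≥ 1` ⟹ `Σ_{b′} e^{−a·pl1(x − posz b′)} ≤ m·(2(d + a)∕a)^d` for every `x`
(S66 f3a `sum_exp_pl1_comp_le` + S79 `K₁_le_of_pos`) — NO `T`, NO `η`, NO `#Λz`. [folklore] -/
theorem rowSum_coarse_le (posz : Λz → TPt d T) {m : ℕ}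
    (hm : ∀ x, (Finset.univ.filter fun b' => posz b' = x).card ≤ m) (hd : 0 < d) {a : ℝ} (ha : 0 < a)
    (x : TPt d T) : ∑ b', Real.exp (-(a * pl1 (x - posz b'))) ≤ m * (2 * (d + a) / a) ^ d :=
  (sum_exp_pl1_comp_le posz hm ha x).trans (mul_le_mul_of_nonneg_left (K₁_le_of_pos hd ha) (Nat.cast_nonneg m))

/-- **S92's ROW `hM𝒢'` INHABITED BY ONE LEVEL-FREE REAL IN THE COARSE READING** (literal shape
`∀ x, Σ_{b′} e^{−((δ𝒢 − δw)·dis x (posz b′))} ≤ M𝒢` with `dis x y := pl1 (x − y)` on the unit torus, `δw < δ𝒢`):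
`M𝒢 := m·(2(d + (δ𝒢−δw))∕(δ𝒢−δw))^d` serves every cell count `T`, hence every level and every comparison; the same for
`Mι MH MH₁`. [folklore] -/
theorem hM_coarse_inhabited (posz : Λz → TPt d T) {m : ℕ}
    (hm : ∀ x, (Finset.univ.filter fun b' => posz b' = x).card ≤ m) (hd : 0 < d) {δ𝒢 δw : ℝ} (hδ : δw < δ𝒢) :
    ∀ x : TPt d T, ∑ b', Real.exp (-((δ𝒢 - δw) * (fun x y : TPt d T => pl1 (x - y)) x (posz b'))) ≤
      m * (2 * (d + (δ𝒢 - δw)) / (δ𝒢 - δw)) ^ d :=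
  fun x => rowSum_coarse_le posz hm hd (sub_pos.2 hδ) x

end Coarse

/-! ## §4 `Kw`: the level-INDEXED inhabitant `Kw_j ∝ η_j^{−d}` of the located count in the designed fine reading (the
constructive half of the owner's repair (b); the volume-weighted count is S79 §3, level-free) -/

section Count

variable {𝔭 : Type*} [Fintype 𝔭] {d T : ℕ} [NeZero T]

/-- **`hKw` HOLDS AT EVERY LEVEL WITH `Kw_j := (#B₀·m·(2(d+δw)∕δw)^d)·η_j^{−d}`**: plaquettes placed on the fine torus
(`≤ m` per fine site), the designed pin depth `ϖPw p := η·pinDist B₀ (posP p)` (PHYSICAL distance to an η-free-sized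
reference set `B₀`, e.g. the block's UNIT-lattice sites), `δw > 0`, `0 < η ≤ 1`, `d ≥ 1` ⟹ for EVERY `P_w`
`Σ_{p ∈ P_w} e^{−δw·ϖPw p} ≤ (#B₀·m·(2(d + δw)∕δw)^d)·(η^d)⁻¹` — S92's `hKw` shape (S79 §3 `sum_eta_exp_neg_pinDist_le`
divided by `η^d`).  With
`d = 4` this is the `c·η_j^{−4}` the owner's `no_levelBlind_cap` says a SHARED `Kw` cannot dominate, and the `η_j⁴` it
lacks is supplied per plaquette by the Wilson slot's `S̄²` (F-ne7cp1-g31-1). [folklore] -/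
theorem levelIndexed_Kw (posP : 𝔭 → TPt d T) {m : ℕ}
    (hm : ∀ x, (Finset.univ.filter fun p => posP p = x).card ≤ m) (B₀ : Finset (TPt d T)) (hB₀ : B₀.Nonempty)
    (hd : 0 < d) {δw η : ℝ} (hδw : 0 < δw) (hη : 0 < η) (hη1 : η ≤ 1) (Pw : Finset 𝔭) :
    ∑ p ∈ Pw, Real.exp (-(δw * (η * pinDist B₀ hB₀ (posP p)))) ≤
      (B₀.card * (m * (2 * (d + δw) / δw) ^ d)) * (η ^ d)⁻¹ := by
  have h := sum_eta_exp_neg_pinDist_le posP hm B₀ hB₀ hd hδw hη hη1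
  rw [← Finset.mul_sum] at h
  rw [le_mul_inv_iff₀' (pow_pos hη d)]
  exact (mul_le_mul_of_nonneg_left (Finset.sum_le_univ_sum_of_nonneg fun p => (Real.exp_pos _).le)
    (pow_pos hη d).le).trans h

end Count

/-! ## §5 `LK`: a FINE term index with O(1) sizes is level-blind-uninhabitable; the designed COARSE index is level-free
by S69 §4 -/

section Terms

/-- **`LK` CAPS THE SIZE-WEIGHTED COUNT OF DEPTH-ZERO TERMS** (S80 f3's ∕ S92's (T3) row
`hK : Σ_{i ∈ I} 2e_i∕r_E·e^{−δ′·ϖP i} ≤ LK` verbatim): if every depth-0 term has size `≥ e₀`, then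
`(2e₀∕r_E)·#{i ∈ I ∣ ϖP i = 0} ≤ LK` — so a term index whose depth-0 members are `c·η_j^{−4}` FINE objects of size O(1)
admits no shared `LK` (owner's `no_levelBlind_cap`), while the DESIGNED (T3) index — E-terms on UNIT-lattice localization
domains, COARSE — gives a level-free `LK` by S69 §4 `sum_mul_le_of_pinned` + `sum_exp_neg_pinDist_le` (by name).
[folklore] -/
theorem LK_ge_depthZero {𝔱 : Type*} (I : Finset 𝔱) (ee : 𝔱 → ℝ) (ϖP : 𝔱 → ℝ) {rE δ' LK e₀ : ℝ} (hrE : 0 < rE)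
    (he0 : ∀ i ∈ I, 0 ≤ ee i) (hK : ∑ i ∈ I, 2 * ee i / rE * Real.exp (-(δ' * ϖP i)) ≤ LK)
    (hbig : ∀ i ∈ I, ϖP i = 0 → e₀ ≤ ee i) :
    2 * e₀ / rE * ((I.filter fun i => ϖP i = 0).card : ℝ) ≤ LK := by
  calc 2 * e₀ / rE * ((I.filter fun i => ϖP i = 0).card : ℝ)
      = ∑ _i ∈ I.filter (fun i => ϖP i = 0), 2 * e₀ / rE := by
        rw [Finset.sum_const, nsmul_eq_mul, mul_comm]
    _ ≤ ∑ i ∈ I.filter (fun i => ϖP i = 0), 2 * ee i / rE * Real.exp (-(δ' * ϖP i)) :=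
        Finset.sum_le_sum fun i hi => by
          obtain ⟨hiI, h0⟩ := Finset.mem_filter.1 hi
          rw [h0, mul_zero, neg_zero, Real.exp_zero, mul_one]
          exact div_le_div_of_nonneg_right (by linarith [hbig i hiI h0]) hrE.le
    _ ≤ ∑ i ∈ I, 2 * ee i / rE * Real.exp (-(δ' * ϖP i)) :=
        Finset.sum_le_sum_of_subset_of_nonneg (Finset.filter_subset _ _) fun i hi _ =>
          mul_nonneg (div_nonneg (by linarith [he0 i hi]) hrE.le) (Real.exp_pos _).le
    _ ≤ LK := hK

end Terms

/-! ## §6 Non-vacuity of §1 and sharpness of §2∕§3 on the smallest torus -/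

/-- On `(ℤ∕2ℤ)¹` with `B₀ = {0}`: the pin vanishes at `0` (§1), and a plaquette family whose single member reads the bond
at `0` has that member at depth `0` whatever `η` is — `#{…} = 1 ≤ Kw` for any `Kw` dominating the located count.
[folklore] -/
example : pinDist ({0} : Finset (TPt 1 2)) (Finset.singleton_nonempty 0) 0 = 0 :=
  pinDist_eq_zero_of_mem _ _ (Finset.mem_singleton_self 0)

/-- The coarse bound of §3 at `d = 1`, `a = 1`, one index per cell: every row sum is `≤ 1·(2(1+1)∕1)^1 = 4`, on EVERY
torus `(ℤ∕Tℤ)¹` (numerically `≤ 4`). [folklore] -/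
example (T : ℕ) [NeZero T] (x : TPt 1 T) : ∑ b' : TPt 1 T, Real.exp (-(1 * pl1 (x - id b'))) ≤ 4 :=
  (rowSum_coarse_le (id : TPt 1 T → TPt 1 T) (m := 1)
    (fun x => by
      rw [Finset.card_le_one]
      intro a ha b hb
      simp only [Finset.mem_filter, Finset.mem_univ, true_and, id] at ha hb
      rw [ha, hb])
    Nat.one_pos one_pos x).trans (by norm_num)

end Summit.QuantumFields.BalabanUV.T4Continuum.ShellMeasureLiveEndLevelBlindRows

end
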